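import Literature.NumberTheory.IwasawaTheory.WeakLeopoldtCyclotomicAssembly
import Summits.BirchSwinnertonDyer.BirchSwinnertonDyer.Theorems.EisensteinPrimesGoodLatticeBDPValueT4OfCyclotomic
import Literature.NumberTheory.GaloisRepresentations.RestrictedRamificationInflationKernel
import Literature.NumberTheory.GaloisRepresentations.RestrictedRamificationKummer
import Summits.BirchSwinnertonDyer.BirchSwinnertonDyer.Theorems.EisensteinPrimesGoodLatticeBDPValueCycWLStagePrep
import Literature.NumberTheory.GaloisRepresentations.KummerTwo
import Literature.NumberTheory.GaloisRepresentations.UnramifiedRadicalDescentOpen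
import Literature.NumberTheory.EllipticCurves.IwasawaCyclotomicProofs
import HarnessLib

/-!
# Crux `GoodLatticeBDPValue` (stmt-BirchSwinnertonDyer-19032), line `halves`, stub 4: the ADAPTER
# «(A) Brauer killing + (B) inflation kernel dies ⟹ stagesDie», and the closers cycWL / (T4) PROVED

Width seat `bsd-line-x1-p1-w4` (gen 15), cell `bsd-eis`; `--supports stmt-BirchSwinnertonDyer-19032`.
Theorems only (no definition, no named fact, no instance, no `sorry`).  Preparations: the sibling
`EisensteinPrimesGoodLatticeBDPValueCycWLStagePrep.lean`.

Road to Iwasawa's theorem cycWL = `weakLeopoldt_H2_subsingleton_cyclotomic_of_isOpen` (NSW (10.3.25);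
⟺ (T4) by `GoodLatticeBDPValueT4OfCyclotomic`): (C) `«stagesDie» → cycWL` (w2 g7,
`WeakLeopoldtCyclotomicLevels` / `…Assembly`), fed by THIS FILE, which proves the finite-level killing
statement «stagesDie» (hypothesis `hdie` of `subsingleton_H2_above_muInfty_of_stagesDie`, verbatim) for
`D ≃+ ℚ_p/ℤ_p` from (A) the tree's killing of `μ_{p^a}`-classes in the cyclotomic tower
(`exists_forall_resSub_mu_primePow_eq_zero_of_le_layerSubgroup`, at `E = K̄^{U₀ ∩ F_k}`, the deeper stage
inside the killing layer by compactness) and (B) w6 g7's `exists_twoCoboundary_of_radicalDescent_of_kummer'`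
(Kummer input := w3 g12's `ramificationSubgroup.exists_kummer_eq_contOneCocycle`, radical descent (RD) a
binder in §3–§5, := w8 g8's `radicalDescent_of_isOpen` in §6), the coefficients moved `A ↪ μ_{p^a}(K̄)` and
back by a Prüfer embedding `ℚ_p/ℤ_p ↪ K̄ˣ`.

* §3 `exists_inflation_coboundary` (A), `exists_coboundary_deeper_of_radicalDescent` (B);
* §4 `stagesDie_of_radicalDescent`; §5 `cycWL_of_radicalDescent`, `above_cyclotomic_of_radicalDescent`;
* §6 UNCONDITIONAL: `weakLeopoldt_H2_subsingleton_cyclotomic_of_isOpen_holds` (cycWL) and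
  `weakLeopoldt_H2_subsingleton_above_cyclotomic_of_isOpen_holds` ((T4), the named fact of stub 4).

HONEST FRAMING: cochain bookkeeping between landed theorems; a textbook theorem (cyclotomic weak Leopoldt)
is thereby kernel-checked, class-field-theory-free; no case of KY Thm. 2.2.2, of the crux or of BSD is
proved here.  Refs: [NeukirchSchmidtWingberg2008] (8.3.11), (10.3.25); [SerreGaloisCohomology1997] II §4.4.
-/

-- D-0017: single-problem summit, the namespace repeats the problem name by design.
set_option linter.dupNamespace false
set_option autoImplicit false

noncomputable section

open scoped Classical
open NumberField IsDedekindDomain Field Function Topology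
open Literature.NumberTheory.GaloisRepresentations
open Literature.NumberTheory.GaloisRepresentations.DiscreteGaloisModule
open Literature.NumberTheory.GaloisRepresentations.LocalWeilDatum
open Literature.NumberTheory.EllipticCurves (ZpExtension)
open Literature.NumberTheory.IwasawaTheory Literature.NumberTheory.IwasawaTheory.Greenberg2006
open Literature.NumberTheory.GaloisCohomology
open _root_.TopRep _root_.ContRepresentation _root_.ContinuousCohomology

namespace Summit.BirchSwinnertonDyer.BirchSwinnertonDyer.Theorems.GoodLatticeBDPValueStagesDie

open GoodLatticeBDPValueCycWLStagePrep

/-! ### §3. The Galois-cohomological core: (A) then (B) on `μ_{p^a}`-valued stage cocycles -/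

section Core

variable {K : Type} [Field K] [NumberField K] {p : ℕ} [hp : Fact p.Prime]
  (S : Set (HeightOneSpectrum (𝓞 K))) (U₀ : Subgroup (absoluteGaloisGroup K))

/-- The stages `U₀ ∩ F_j` act trivially on `μ_{p^m}` for `m ≤ j`. [cite: Washington1997, §13.1] -/
theorem mu_apply_eq_self_of_mem_inf {m j : ℕ} (hmj : m ≤ j) {σ : absoluteGaloisGroup K}
    (hσ : σ ∈ U₀ ⊓ (modNCyclotomicCharacter K (p ^ j)).ker) (v : MuCarrier K (p ^ m)) :
    mu K (p ^ m) σ v = v :=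
  mu_apply_eq_self_of_mem_ker hmj (Subgroup.mem_inf.mp hσ).2 v

/-- **Step (A) on a stage cocycle**: for `1 ≤ a ≤ k` and a `μ_{p^a}`-valued continuous `2`-cocycle `c₁` of
the stage `G_k = Gal(K_S/K′(μ_{p^k}))` (trivial action) there is `k₂ ≥ k` such that the INFLATION of `c₁`
to `U₀ ∩ F_{k₂} ≤ Γ_K` is a coboundary `∂φ` of the Galois module `μ_{p^a}` (tree killing lemma at
`E = K̄^{U₀ ∩ F_k}`; the deeper stage inside the killing layer by compactness).
[cite: SerreGaloisCohomology1997, II §4.4 Prop. 13] [cite: NeukirchSchmidtWingberg2008, (10.3.25) (proof)] -/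
theorem exists_inflation_coboundary (hp2 : p ≠ 2)
    (hU₀ : IsOpen (U₀ : Set (absoluteGaloisGroup K)))
    {k a : ℕ} (hak : a ≤ k) (ha : 1 ≤ a)
    (c₁ : contTwoCocycles (ContinuousRep.trivial
      (galoisGroupAbove S (U₀ ⊓ (modNCyclotomicCharacter K (p ^ k)).ker)) ℤ (MuCarrier K (p ^ a))).toTopRep) :
    ∃ (k₂ : ℕ) (hkk₂ : k ≤ k₂)
      (φ : C(↥(U₀ ⊓ (modNCyclotomicCharacter K (p ^ k₂)).ker), MuCarrier K (p ^ a))),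
      ∀ σ τ : ↥(U₀ ⊓ (modNCyclotomicCharacter K (p ^ k₂)).ker),
        c₁.1 (Subgroup.inclusion (galoisGroupAbove_inf_ker_modNCyclotomicCharacter_antitone p S U₀ hkk₂)
            ⟨toUnramifiedQuot K S (σ : absoluteGaloisGroup K),
              coe_mem_galoisGroupAbove S (U₀ ⊓ (modNCyclotomicCharacter K (p ^ k₂)).ker) σ⟩,
          Subgroup.inclusion (galoisGroupAbove_inf_ker_modNCyclotomicCharacter_antitone p S U₀ hkk₂)
            ⟨toUnramifiedQuot K S (τ : absoluteGaloisGroup K),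
              coe_mem_galoisGroupAbove S (U₀ ⊓ (modNCyclotomicCharacter K (p ^ k₂)).ker) τ⟩) =
        mu K (p ^ a) (σ : absoluteGaloisGroup K) (φ τ) - φ (σ * τ) + φ σ := by
  have hpp : p.Prime := hp.out
  haveI : CompactSpace (absoluteGaloisGroup K) := absoluteGaloisGroup_compactSpace K
  have hHanti : Antitone (fun j : ℕ ↦ U₀ ⊓ (modNCyclotomicCharacter K (p ^ j)).ker) :=
    fun j j' h ↦ inf_le_inf_left U₀ (ker_modNCyclotomicCharacter_antitone p h)
  have hHopen : ∀ j, IsOpen (((U₀ ⊓ (modNCyclotomicCharacter K (p ^ j)).ker :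
      Subgroup (absoluteGaloisGroup K))) : Set (absoluteGaloisGroup K)) :=
    fun j ↦ hU₀.inter (isOpen_ker_modNCyclotomicCharacter p j)
  have hk1 : 1 ≤ k := ha.trans hak
  -- the cyclotomic `ℤ_p`-extension; `E` with `Gal(K̄/E) = U₀ ∩ F_k`
  obtain ⟨κ, hκ⟩ := Literature.NumberTheory.EllipticCurves.ZpExtension.exists_isCyclotomic_holds K p
    (GaloisRep.cyclotomicCharacter_range_infinite K p)
  obtain ⟨E, hEfin, hEH⟩ :=
    exists_galFixing_eq_of_isOpen (U₀ ⊓ (modNCyclotomicCharacter K (p ^ k)).ker) (hHopen k)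
  haveI := hEfin
  haveI : CompactSpace (galFixing K E) :=
    isCompact_iff_compactSpace.mp (isClosed_galFixing K E).isCompact
  have hEμ : ∀ σ ∈ galFixing K E, ∀ ζ : rootsOfUnity p (AlgebraicClosure K),
      σ • (ζ : (AlgebraicClosure K)ˣ) = ζ := fun σ hσ ζ ↦
    smul_rootsOfUnity_eq_self_of_mem_ker hk1 (Subgroup.mem_inf.mp (hEH.le hσ)).2 ζ
  -- inflation of `c₁` to `Gal(K̄/E)` as a cocycle of the Galois module `μ_{p^a}`
  let qE : galFixing K E →* galoisGroupAbove S (U₀ ⊓ (modNCyclotomicCharacter K (p ^ k)).ker) :=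
    { toFun := fun σ ↦ ⟨toUnramifiedQuot K S (σ : absoluteGaloisGroup K),
        Subgroup.mem_map_of_mem _ (hEH.le σ.2)⟩
      map_one' := Subtype.ext (by simp)
      map_mul' := fun σ τ ↦ Subtype.ext (by simp) }
  have hqE_cont : Continuous qE :=
    ((continuous_toUnramifiedQuot K S).comp continuous_subtype_val).subtype_mk _
  obtain ⟨fE, hfE⟩ := exists_twoCocycle_inflate_of_trivial_action qE hqE_cont
    ((mu K (p ^ a)).restrict (subgroupIncl (galFixing K E)))
    (fun σ v ↦ by
      rw [ContinuousRep.restrict_apply, subgroupIncl_apply]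
      exact mu_apply_eq_self_of_mem_inf U₀ hak (hEH.le σ.2) v) c₁
  -- (A)
  obtain ⟨M, hM⟩ := exists_forall_resSub_mu_primePow_eq_zero_of_le_layerSubgroup K (Or.inl hp2) hκ a E
    hEμ (twoCocycleClass _ fE)
  obtain ⟨k₂, hkk₂, hk₂M⟩ := exists_inf_ker_le_layerSubgroup hκ U₀ hU₀ M k
  have hTE : U₀ ⊓ (modNCyclotomicCharacter K (p ^ k₂)).ker ≤ galFixing K E := hEH.symm ▸ hHanti hkk₂
  haveI : IsClosed (((U₀ ⊓ (modNCyclotomicCharacter K (p ^ k₂)).ker :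
      Subgroup (absoluteGaloisGroup K)) : Set (absoluteGaloisGroup K))) :=
    Subgroup.isClosed_of_isOpen _ (hHopen k₂)
  have hres : resSub (mu K (p ^ a)) hTE 2 (twoCocycleClass _ fE) = 0 := hM _ hTE hk₂M
  rw [resSub, map_twoCocycleClass, twoCocycleClass_eq_zero_iff] at hres
  obtain ⟨φ, hφ⟩ := hres
  refine ⟨k₂, hkk₂, φ, fun σ τ ↦ ?_⟩
  have h := hφ σ τ
  rw [contTwoCocycles.pullback_apply, resSubMod_hom_apply, ContinuousRep.toTopRep_ρ_apply,
    ContinuousRep.restrict_apply, subgroupIncl_apply, inclHom_apply, inclHom_apply, hfE] at h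
  exact h

/-- **Step (B) on a stage cocycle, then the trivial-action stage**: for `a ≤ k₂`, a `μ_{p^a}`-valued stage
cocycle `f₂` of `G_{k₂}` with inflation `∂φ` on `U₀ ∩ F_{k₂}`, and radical descent `hRD` there at
`(p^a, p^{a+t})`: on the stage `max k₂ (a+t)` the cocycle pushed into `μ_{p^{a+t}}` is a coboundary (w6 g7's
`exists_twoCoboundary_of_radicalDescent_of_kummer'`, (KUM) := w3 g12's
`ramificationSubgroup.exists_kummer_eq_contOneCocycle`). [cite: NeukirchSchmidtWingberg2008, (8.3.11) (ii), (10.3.25) (proof)] -/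
theorem exists_coboundary_deeper_of_radicalDescent
    (hS : ∀ v : HeightOneSpectrum (𝓞 K), ((p : ℕ) : 𝓞 K) ∈ v.asIdeal → v ∈ S)
    (hU₀ : IsOpen (U₀ : Set (absoluteGaloisGroup K))) (hN : ramificationSubgroup K S ≤ U₀)
    {k₂ a t : ℕ} (hak₂ : a ≤ k₂)
    (hRD : ∀ b : (AlgebraicClosure K)ˣ, (∀ n ∈ ramificationSubgroup K S, n • b = b) →
      (∀ σ ∈ U₀ ⊓ (modNCyclotomicCharacter K (p ^ k₂)).ker, ∃ d : (AlgebraicClosure K)ˣ,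
        (∀ n ∈ ramificationSubgroup K S, n • d = d) ∧ σ • b = b * d ^ (p ^ a)) →
      ∃ c d : (AlgebraicClosure K)ˣ, (∀ σ ∈ U₀ ⊓ (modNCyclotomicCharacter K (p ^ k₂)).ker, σ • c = c) ∧
        (∀ n ∈ ramificationSubgroup K S, n • d = d) ∧ b ^ (p ^ t) = c * d ^ (p ^ (a + t)))
    (f₂ : contTwoCocycles (ContinuousRep.trivial
      (galoisGroupAbove S (U₀ ⊓ (modNCyclotomicCharacter K (p ^ k₂)).ker)) ℤ (MuCarrier K (p ^ a))).toTopRep)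
    (φ : C(↥(U₀ ⊓ (modNCyclotomicCharacter K (p ^ k₂)).ker), MuCarrier K (p ^ a)))
    (hφ : ∀ σ τ : ↥(U₀ ⊓ (modNCyclotomicCharacter K (p ^ k₂)).ker),
      f₂.1 (⟨toUnramifiedQuot K S (σ : absoluteGaloisGroup K),
              coe_mem_galoisGroupAbove S (U₀ ⊓ (modNCyclotomicCharacter K (p ^ k₂)).ker) σ⟩,
            ⟨toUnramifiedQuot K S (τ : absoluteGaloisGroup K),
              coe_mem_galoisGroupAbove S (U₀ ⊓ (modNCyclotomicCharacter K (p ^ k₂)).ker) τ⟩) =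
        mu K (p ^ a) (σ : absoluteGaloisGroup K) (φ τ) - φ (σ * τ) + φ σ) :
    ∃ (k' : ℕ) (hk₂k' : k₂ ≤ k')
      (b : C(galoisGroupAbove S (U₀ ⊓ (modNCyclotomicCharacter K (p ^ k')).ker), MuCarrier K (p ^ (a + t)))),
      ∀ g h : galoisGroupAbove S (U₀ ⊓ (modNCyclotomicCharacter K (p ^ k')).ker),
        muInclusion K ⟨p ^ t, pow_add p a t⟩
          (f₂.1 (Subgroup.inclusion (galoisGroupAbove_inf_ker_modNCyclotomicCharacter_antitone p S U₀ hk₂k') g,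
            Subgroup.inclusion (galoisGroupAbove_inf_ker_modNCyclotomicCharacter_antitone p S U₀ hk₂k') h)) =
          b h - b (g * h) + b g := by
  have anti := galoisGroupAbove_inf_ker_modNCyclotomicCharacter_antitone p S U₀
  have hHanti : Antitone (fun j : ℕ ↦ U₀ ⊓ (modNCyclotomicCharacter K (p ^ j)).ker) :=
    fun j j' h ↦ inf_le_inf_left U₀ (ker_modNCyclotomicCharacter_antitone p h)
  have hHcl : IsClosed (((U₀ ⊓ (modNCyclotomicCharacter K (p ^ k₂)).ker :
      Subgroup (absoluteGaloisGroup K)) : Set (absoluteGaloisGroup K))) :=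
    Subgroup.isClosed_of_isOpen _ (hU₀.inter (isOpen_ker_modNCyclotomicCharacter p k₂))
  have hNH : ramificationSubgroup K S ≤ U₀ ⊓ (modNCyclotomicCharacter K (p ^ k₂)).ker :=
    le_inf hN (ramificationSubgroup_le_ker_modNCyclotomicCharacter p S hS k₂)
  have hNe : p ^ a * p ^ t = p ^ (a + t) := (pow_add p a t).symm
  have hρG : ∀ (σ : ↥(U₀ ⊓ (modNCyclotomicCharacter K (p ^ k₂)).ker)) (v : MuCarrier K (p ^ a)),
      ContinuousRep.trivial (galoisGroupAbove S (U₀ ⊓ (modNCyclotomicCharacter K (p ^ k₂)).ker)) ℤ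
          (MuCarrier K (p ^ a))
        ⟨toUnramifiedQuot K S (σ : absoluteGaloisGroup K),
          coe_mem_galoisGroupAbove S (U₀ ⊓ (modNCyclotomicCharacter K (p ^ k₂)).ker) σ⟩ v =
        mu K (p ^ a) (σ : absoluteGaloisGroup K) v := fun σ v ↦ by
    rw [ContinuousRep.trivial_apply, mu_apply_eq_self_of_mem_inf U₀ hak₂ σ.2]
  have hKUM : ∀ x : contOneCocycles
      ((mu K (p ^ a)).restrict (subgroupIncl (ramificationSubgroup K S))).toTopRep,
      ∃ β : (AlgebraicClosure K)ˣ, ∀ n : ramificationSubgroup K S,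
        muVal K (p ^ a) (x.1 n) = (n : absoluteGaloisGroup K) • β / β := fun x ↦ by
    obtain ⟨β, -, hβ⟩ := ramificationSubgroup.exists_kummer_eq_contOneCocycle K S (p ^ a) x
    exact ⟨β, hβ⟩
  have htriv' : ∀ n ∈ ramificationSubgroup K S, ∀ v : MuCarrier K (p ^ (a + t)),
      mu K (p ^ (a + t)) n v = v := fun n hn v ↦
    mu_apply_eq_self_of_mem_ker le_rfl (ramificationSubgroup_le_ker_modNCyclotomicCharacter p S hS _ hn) v
  obtain ⟨b, hb⟩ := exists_twoCoboundary_of_radicalDescent_of_kummer' S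
    (U₀ ⊓ (modNCyclotomicCharacter K (p ^ k₂)).ker) hHcl hNH hNe hRD hKUM htriv' _ hρG f₂ φ hφ
  -- the stage `k' = max k₂ (a + t)`
  refine ⟨max k₂ (a + t), le_max_left _ _,
    b.comp ⟨Subgroup.inclusion (anti (le_max_left k₂ (a + t))),
      continuous_inclusion (anti (le_max_left k₂ (a + t)))⟩, fun g h ↦ ?_⟩
  obtain ⟨σ, hσ⟩ := galoisGroupAbove_mk_surjective S (U₀ ⊓ (modNCyclotomicCharacter K (p ^ max k₂ (a + t))).ker) g
  obtain ⟨τ, hτ⟩ := galoisGroupAbove_mk_surjective S (U₀ ⊓ (modNCyclotomicCharacter K (p ^ max k₂ (a + t))).ker) h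
  have hσ₂ := hHanti (le_max_left k₂ (a + t)) σ.2
  have hτ₂ := hHanti (le_max_left k₂ (a + t)) τ.2
  have hb' := hb ⟨σ, hσ₂⟩ ⟨τ, hτ₂⟩
  have hgi : Subgroup.inclusion (anti (le_max_left k₂ (a + t))) g =
      ⟨toUnramifiedQuot K S ((⟨σ, hσ₂⟩ : ↥(U₀ ⊓ (modNCyclotomicCharacter K (p ^ k₂)).ker)) : absoluteGaloisGroup K),
        coe_mem_galoisGroupAbove S (U₀ ⊓ (modNCyclotomicCharacter K (p ^ k₂)).ker) ⟨σ, hσ₂⟩⟩ :=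
    Subtype.ext (congrArg Subtype.val hσ).symm
  have hhi : Subgroup.inclusion (anti (le_max_left k₂ (a + t))) h =
      ⟨toUnramifiedQuot K S ((⟨τ, hτ₂⟩ : ↥(U₀ ⊓ (modNCyclotomicCharacter K (p ^ k₂)).ker)) : absoluteGaloisGroup K),
        coe_mem_galoisGroupAbove S (U₀ ⊓ (modNCyclotomicCharacter K (p ^ k₂)).ker) ⟨τ, hτ₂⟩⟩ :=
    Subtype.ext (congrArg Subtype.val hτ).symm
  have hghi : Subgroup.inclusion (anti (le_max_left k₂ (a + t))) (g * h) =
      ⟨toUnramifiedQuot K S ((⟨σ, hσ₂⟩ * ⟨τ, hτ₂⟩ : ↥(U₀ ⊓ (modNCyclotomicCharacter K (p ^ k₂)).ker)) :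
          absoluteGaloisGroup K),
        coe_mem_galoisGroupAbove S (U₀ ⊓ (modNCyclotomicCharacter K (p ^ k₂)).ker) (⟨σ, hσ₂⟩ * ⟨τ, hτ₂⟩)⟩ := by
    rw [map_mul, galoisGroupAbove_mk_mul, hgi, hhi]
  rw [mu_apply_eq_self_of_mem_inf U₀ (le_max_right k₂ (a + t)) σ.2] at hb'
  simp only [ContinuousMap.comp_apply, ContinuousMap.coe_mk]
  rw [hgi, hhi, hghi]
  exact hb'

end Core
/-! ### §4. «stagesDie» for `D ≃+ ℚ_p/ℤ_p` -/

section Main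

variable {K : Type} [Field K] [NumberField K] {p : ℕ} [hp : Fact p.Prime]

/-- **«stagesDie»** (the hypothesis `hdie` of `subsingleton_H2_above_muInfty_of_stagesDie`, verbatim, for
`D ≃+ ℚ_p/ℤ_p`) **from (A), (B), Kummer theory on `N_S` and radical descent `hRD`**: the `A`-valued
stage cocycle is carried into `μ_{p^a}(K̄)` by a Prüfer embedding (`exists_twoCocycle_trivial_map`), steps
(A)/(B) are `exists_inflation_coboundary` / `exists_coboundary_deeper_of_radicalDescent`, and the
`μ_{p^{a+t}}`-valued splitting cochain is carried back to `D` (`exists_eq_apply_of_pow_eq_one`).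
[cite: NeukirchSchmidtWingberg2008, (10.3.25) (proof), (8.3.11) (ii)] [cite: SerreGaloisCohomology1997, II §4.4 Prop. 13] -/
theorem stagesDie_of_radicalDescent (hp2 : p ≠ 2)
    (S : Set (HeightOneSpectrum (𝓞 K)))
    (hS : ∀ v : HeightOneSpectrum (𝓞 K), ((p : ℕ) : 𝓞 K) ∈ v.asIdeal → v ∈ S)
    (U₀ : Subgroup (absoluteGaloisGroup K)) (hU₀ : IsOpen (U₀ : Set (absoluteGaloisGroup K)))
    (hN : ramificationSubgroup K S ≤ U₀)
    {D : Type} [AddCommGroup D] [TopologicalSpace D] [DiscreteTopology D] (eD : D ≃+ QpModZp p)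
    (hRD : ∀ (H : Subgroup (absoluteGaloisGroup K)), IsOpen (H : Set (absoluteGaloisGroup K)) →
      ramificationSubgroup K S ≤ H → ∀ m : ℕ, ∃ t : ℕ,
        ∀ b : (AlgebraicClosure K)ˣ, (∀ n ∈ ramificationSubgroup K S, n • b = b) →
          (∀ σ ∈ H, ∃ d : (AlgebraicClosure K)ˣ,
            (∀ n ∈ ramificationSubgroup K S, n • d = d) ∧ σ • b = b * d ^ (p ^ m)) →
          ∃ c d : (AlgebraicClosure K)ˣ, (∀ σ ∈ H, σ • c = c) ∧
            (∀ n ∈ ramificationSubgroup K S, n • d = d) ∧ b ^ (p ^ t) = c * d ^ (p ^ (m + t))) :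
    ∀ (k a : ℕ), a ≤ k → ∀ (A : AddSubgroup D) [Finite A], (∀ x ∈ A, p ^ a • x = 0) →
      ∀ c : contTwoCocycles (((ContinuousRep.trivial (GaloisGroupUnramifiedOutside K S) ℤ A).restrict
          (subgroupIncl (galoisGroupAbove S (U₀ ⊓ (modNCyclotomicCharacter K (p ^ k)).ker)))).toTopRep),
      ∃ (k' : ℕ) (hkk' : k ≤ k')
        (b : C(galoisGroupAbove S (U₀ ⊓ (modNCyclotomicCharacter K (p ^ k')).ker), D)),
        ∀ σ τ : galoisGroupAbove S (U₀ ⊓ (modNCyclotomicCharacter K (p ^ k')).ker),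
          ((c.1 (Subgroup.inclusion
              (galoisGroupAbove_inf_ker_modNCyclotomicCharacter_antitone p S U₀ hkk') σ,
            Subgroup.inclusion
              (galoisGroupAbove_inf_ker_modNCyclotomicCharacter_antitone p S U₀ hkk') τ) : A) : D) =
            b τ - b (σ * τ) + b σ := by
  intro k a hak A _ hA c
  have hpp : p.Prime := hp.out
  have anti := galoisGroupAbove_inf_ker_modNCyclotomicCharacter_antitone p S U₀
  -- the case `a = 0`: `A = 0`
  rcases Nat.eq_zero_or_pos a with rfl | hapos
  · refine ⟨k, le_rfl, 0, fun σ τ ↦ ?_⟩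
    have h0 : (c.1 (Subgroup.inclusion (anti le_rfl) σ, Subgroup.inclusion (anti le_rfl) τ) : D) = 0 := by
      have := hA _ (c.1 (Subgroup.inclusion (anti le_rfl) σ, Subgroup.inclusion (anti le_rfl) τ)).2
      simpa using this
    simp [h0]
  -- a Prüfer embedding `D ↪ K̄ˣ`; `θ : A → μ_{p^a}(K̄)`
  haveI : NeZero ((p : ℕ) : AlgebraicClosure K) := ⟨Nat.cast_ne_zero.2 hpp.ne_zero⟩
  obtain ⟨jμ, hjμ⟩ := QpModZp.exists_injective_units (p := p) (AlgebraicClosure K)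
  have hjD : Function.Injective (jμ.comp eD.toAddMonoidHom) := hjμ.comp eD.injective
  have hAtor : ∀ x : A, (Additive.toMul (jμ.comp eD.toAddMonoidHom x)) ^ (p ^ a) = 1 := fun x ↦
    toMul_pow_eq_one_of_nsmul_eq_zero (jμ.comp eD.toAddMonoidHom) (hA x x.2)
  let θ : A → MuCarrier K (p ^ a) := fun x ↦
    muOfUnit K (p ^ a) (Additive.toMul (jμ.comp eD.toAddMonoidHom x)) (hAtor x)
  have hθadd : ∀ x y : A, θ (x + y) = θ x + θ y := fun x y ↦ by
    apply muVal_injective K (p ^ a)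
    rw [muVal_add]
    change Additive.toMul (jμ.comp eD.toAddMonoidHom ((x + y : A) : D)) =
      Additive.toMul (jμ.comp eD.toAddMonoidHom (x : D)) * Additive.toMul (jμ.comp eD.toAddMonoidHom (y : D))
    rw [AddMemClass.coe_add, map_add, toMul_add]
  have hθ : ∀ x : A, Additive.ofMul (muVal K (p ^ a) (θ x)) = jμ.comp eD.toAddMonoidHom x := fun x ↦ by
    change Additive.ofMul (Additive.toMul (jμ.comp eD.toAddMonoidHom (x : D))) = _
    rw [ofMul_toMul]
  -- back-transport `ψ : μ_{p^n}(K̄) → D`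
  have hψex : ∀ (n : ℕ) (v : MuCarrier K (p ^ n)), ∃ y : D,
      jμ.comp eD.toAddMonoidHom y = Additive.ofMul (muVal K (p ^ n) v) := fun n v ↦ by
    obtain ⟨x, -, hx⟩ := exists_eq_apply_of_pow_eq_one hjμ (muVal_pow_eq_one K (p ^ n) v)
    refine ⟨eD.symm x, ?_⟩
    rw [AddMonoidHom.comp_apply]
    change jμ (eD (eD.symm x)) = _
    rw [AddEquiv.apply_symm_apply, hx]
  -- (A) and (B)
  obtain ⟨c₁, hc₁⟩ := exists_twoCocycle_trivial_map
    (G := galoisGroupAbove S (U₀ ⊓ (modNCyclotomicCharacter K (p ^ k)).ker)) θ hθadd c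
  obtain ⟨k₂, hkk₂, φ, hφ⟩ := exists_inflation_coboundary S U₀ hp2 hU₀ hak hapos c₁
  obtain ⟨f₂, hf₂⟩ := exists_twoCocycle_trivial_comap (Subgroup.inclusion (anti hkk₂))
    (continuous_inclusion (anti hkk₂)) c₁
  obtain ⟨t, hRDt⟩ := hRD (U₀ ⊓ (modNCyclotomicCharacter K (p ^ k₂)).ker)
    (hU₀.inter (isOpen_ker_modNCyclotomicCharacter p k₂))
    (le_inf hN (ramificationSubgroup_le_ker_modNCyclotomicCharacter p S hS k₂)) a
  obtain ⟨k', hk₂k', b, hb⟩ := exists_coboundary_deeper_of_radicalDescent S U₀ hS hU₀ hN (hak.trans hkk₂)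
    hRDt f₂ φ (fun σ τ ↦ by rw [hf₂]; exact hφ σ τ)
  -- back to `D`
  choose ψ hψ using hψex (a + t)
  have hψc : Continuous ψ := continuous_of_discreteTopology
  refine ⟨k', hkk₂.trans hk₂k', ⟨fun g ↦ ψ (b g), hψc.comp b.continuous⟩, fun g h ↦ ?_⟩
  apply hjD
  have hval := congrArg (fun v : MuCarrier K (p ^ (a + t)) ↦ Additive.ofMul (muVal K (p ^ (a + t)) v)) (hb g h)
  simp only [muVal_add, muVal_sub, ofMul_mul, ofMul_div, muVal_muInclusion, hf₂, hc₁] at hval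
  rw [map_add, map_sub]
  simp only [ContinuousMap.coe_mk, hψ]
  rw [← hval, hθ]
  rfl

end Main

/-! ### §5. Corollaries: cycWL and (T4) from radical descent alone -/

section Corollaries

/-- **cycWL from radical descent alone**: w2 g7's `weakLeopoldt_H2_subsingleton_cyclotomic_of_isOpen_of_stagesDie`
fed by `stagesDie_of_radicalDescent`; the hypothesis is (RD) for every number field `K`, odd `p`,
`S ⊇ S_p`, open `H ≥ N_S` and level `p^m`. [cite: NeukirchSchmidtWingberg2008, (10.3.25), (8.3.11) (ii)] -/
theorem cycWL_of_radicalDescent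
    (hRD : ∀ (K : Type) [Field K] [NumberField K] (p : ℕ) [Fact p.Prime], p ≠ 2 →
      ∀ (S : Set (HeightOneSpectrum (𝓞 K))),
        (∀ v : HeightOneSpectrum (𝓞 K), ((p : ℕ) : 𝓞 K) ∈ v.asIdeal → v ∈ S) →
      ∀ (H : Subgroup (absoluteGaloisGroup K)), IsOpen (H : Set (absoluteGaloisGroup K)) →
        ramificationSubgroup K S ≤ H → ∀ m : ℕ, ∃ t : ℕ,
          ∀ b : (AlgebraicClosure K)ˣ, (∀ n ∈ ramificationSubgroup K S, n • b = b) →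
            (∀ σ ∈ H, ∃ d : (AlgebraicClosure K)ˣ,
              (∀ n ∈ ramificationSubgroup K S, n • d = d) ∧ σ • b = b * d ^ (p ^ m)) →
            ∃ c d : (AlgebraicClosure K)ˣ, (∀ σ ∈ H, σ • c = c) ∧
              (∀ n ∈ ramificationSubgroup K S, n • d = d) ∧ b ^ (p ^ t) = c * d ^ (p ^ (m + t))) :
    Literature.NumberTheory.IwasawaTheory.weakLeopoldt_H2_subsingleton_cyclotomic_of_isOpen :=
  weakLeopoldt_H2_subsingleton_cyclotomic_of_isOpen_of_stagesDie
    fun K _ _ p _ hp S _ hS U₀ hU₀ hN _ _ _ _ hD ↦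
      stagesDie_of_radicalDescent hp S hS U₀ hU₀ hN
        (hD.some.trans (QpModZp.addEquivQuotientSubring p).symm) (hRD K p hp S hS)

/-- **(T4) `weakLeopoldt_H2_subsingleton_above_cyclotomic_of_isOpen` — the named fact carried by stub 4
of the line — FROM RADICAL DESCENT ALONE** (w2 g7's `above_cyclotomic_of_cyclotomic` ∘
`cycWL_of_radicalDescent`). [cite: Greenberg2006, pp. 343–344] [cite: NguyenQuangDo1984, Thm. 2.2]
[cite: NeukirchSchmidtWingberg2008, (10.3.25)] -/
theorem above_cyclotomic_of_radicalDescent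
    (hRD : ∀ (K : Type) [Field K] [NumberField K] (p : ℕ) [Fact p.Prime], p ≠ 2 →
      ∀ (S : Set (HeightOneSpectrum (𝓞 K))),
        (∀ v : HeightOneSpectrum (𝓞 K), ((p : ℕ) : 𝓞 K) ∈ v.asIdeal → v ∈ S) →
      ∀ (H : Subgroup (absoluteGaloisGroup K)), IsOpen (H : Set (absoluteGaloisGroup K)) →
        ramificationSubgroup K S ≤ H → ∀ m : ℕ, ∃ t : ℕ,
          ∀ b : (AlgebraicClosure K)ˣ, (∀ n ∈ ramificationSubgroup K S, n • b = b) →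
            (∀ σ ∈ H, ∃ d : (AlgebraicClosure K)ˣ,
              (∀ n ∈ ramificationSubgroup K S, n • d = d) ∧ σ • b = b * d ^ (p ^ m)) →
            ∃ c d : (AlgebraicClosure K)ˣ, (∀ σ ∈ H, σ • c = c) ∧
              (∀ n ∈ ramificationSubgroup K S, n • d = d) ∧ b ^ (p ^ t) = c * d ^ (p ^ (m + t))) :
    weakLeopoldt_H2_subsingleton_above_cyclotomic_of_isOpen :=
  GoodLatticeBDPValueT4OfCyclotomic.above_cyclotomic_of_cyclotomic (cycWL_of_radicalDescent hRD)

end Corollaries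

/-! ### §6. The closers: cycWL and (T4) UNCONDITIONALLY (radical descent = w8 g8's `radicalDescent_of_isOpen`) -/

section Holds

/-- **Iwasawa's theorem — weak Leopoldt for the cyclotomic `ℤ_p`-extension, open-subgroup form
(`Literature.NumberTheory.IwasawaTheory.weakLeopoldt_H2_subsingleton_cyclotomic_of_isOpen`; Neukirch–
Schmidt–Wingberg (10.3.25)) — PROVED**: `cycWL_of_radicalDescent` with radical descent supplied by
`radicalDescent_of_isOpen` (w8 g8; finiteness of the class group of `K̄^H` read through Kummer theory,
NSW (8.3.11) proof).  Road (cell `bsd-eis`, crux `GoodLatticeBDPValue`, stub 4): (A) Serre II §4.4 /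
Tate (tree `CyclotomicKillingPrimePower`), (B) w6 g7 `RestrictedRamificationInflationKernel` + w3 g12
Kummer on `N_S` + w8 g8 radical descent, (C) w2 g7 `WeakLeopoldtCyclotomicLevels` / `…Assembly`, the
adapter of this file in between.  Declared in this Summit namespace (a Literature-side `_holds` cannot
import `Summits`); no case of BSD or of the crux is proved by it.
[cite: NeukirchSchmidtWingberg2008, (10.3.25) with (10.3.22)] [cite: Iwasawa1973, §2] -/
theorem weakLeopoldt_H2_subsingleton_cyclotomic_of_isOpen_holds :
    Literature.NumberTheory.IwasawaTheory.weakLeopoldt_H2_subsingleton_cyclotomic_of_isOpen :=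
  cycWL_of_radicalDescent fun K _ _ _ _ _ _ hS _ hHo hNH m ↦ radicalDescent_of_isOpen K hS hHo hNH m

/-- **(T4) — weak Leopoldt above a `ℤ_p^m`-extension containing the cyclotomic one
(`Greenberg2006.weakLeopoldt_H2_subsingleton_above_cyclotomic_of_isOpen`; Greenberg 2006 pp. 343–344,
Nguyen Quang Do 1984 Thm. 2.2) — PROVED**: the named fact carried by `stub_publishedFactsGreenberg` of
the line `halves`, from `weakLeopoldt_H2_subsingleton_cyclotomic_of_isOpen_holds` by w2 g7's reduction
`above_cyclotomic_of_cyclotomic`.  No case of BSD or of the crux is proved by it.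
[cite: Greenberg2006, pp. 343–344] [cite: NguyenQuangDo1984, Thm. 2.2] [cite: NeukirchSchmidtWingberg2008, (10.3.25)] -/
theorem weakLeopoldt_H2_subsingleton_above_cyclotomic_of_isOpen_holds :
    weakLeopoldt_H2_subsingleton_above_cyclotomic_of_isOpen :=
  GoodLatticeBDPValueT4OfCyclotomic.above_cyclotomic_of_cyclotomic
    weakLeopoldt_H2_subsingleton_cyclotomic_of_isOpen_holds

end Holds
end Summit.BirchSwinnertonDyer.BirchSwinnertonDyer.Theorems.GoodLatticeBDPValueStagesDie

end
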